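import Literature.Computability.Cryptography.LWEPrimePowerProgDig
import Literature.Computability.Cryptography.LWEPrimePowerProgHist
import HarnessLib

/-!
# The Micciancio–Peikert machine, VI: the query of a round on lists

Topic `Computability/Cryptography` (LWE), grouping namespace `LWE.MP12.Prog`, sequel of
`LWEPrimePowerProgDig.lean` and `LWEPrimePowerProgHist.lean`. Proved material (no named fact) towards
`Literature.Computability.Cryptography.blprs_gapSVP_sqrt_dim_to_lwe_classical` (**pqc.S21**),
hypothesis `h₂`: the query of the round whose index is the length of the answer history —
estimation rounds first (level and repetition by division), then the digit rounds (coordinate, round,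
candidate, trial, half and block by mixed-radix division; the selected step and the loop state read
off the history) — `queryOfL`, with its polynomial-time realisation on codes **`codeFP_queryOfL`**.

## References

* D. Micciancio, C. Peikert, *Trapdoors for lattices: simpler, tighter, faster, smaller*, EUROCRYPT 2012,
  LNCS 7237; full version IACR ePrint 2011/501, §3, Thm. 3.1 proof (pp. 15–16). [MicciancioPeikert2012]
* S. Arora, B. Barak, *Computational Complexity: A Modern Approach*, CUP 2009, §1.3. [AroraBarak2009]
-/

namespace Literature.Computability.Cryptography

namespace LWE

namespace MP12

namespace Prog

open _root_.Computability Polynomial Literature.Computability.Complexity Literature.Computability.Complexity.CodeFP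

/-- The unary copies `(1ᵈ, (1ᴷ, (1ᵉ, (1ᵐ, (1ᵀ, (1ᴺ, 1ᴺ'))))))`. [folklore] -/
abbrev UnT : Type := ℕ × (ℕ × (ℕ × (ℕ × (ℕ × (ℕ × ℕ)))))

/-- Their code. [folklore] -/
abbrev unTE : UnT → List Bool := pairE unE (pairE unE (pairE unE (pairE unE (pairE unE (pairE unE unE)))))

/-- The context of a round: `((P, U), (samples, (coins, history)))`. [folklore] -/
abbrev QCtx : Type := (PrmT × UnT) × (List LItem × (List Bool × List Bool))

/-- Its code. [folklore] -/
abbrev qCtxE : QCtx → List Bool := pairE (pairE prmE unTE) (pairE (rawE itemE) (pairE strE strE))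

/-- **The digit position decoded**: `(c, (i', (k, (t, (h, b)))))` from `r₀ = idx - nEst`. [folklore] -/
def digDecode (P : PrmT) (r₀ : ℕ) : ℕ × (ℕ × (ℕ × (ℕ × (ℕ × ℕ)))) :=
  let PP := 2 * (P.T * (2 * P.N))
  let r₁ := r₀ % (P.e * PP)
  let r₂ := r₁ % PP
  let r₃ := r₂ % (P.T * (2 * P.N))
  let r₄ := r₃ % (2 * P.N)
  (r₀ / (P.e * PP), (r₁ / PP, (r₂ / (P.T * (2 * P.N)), (r₃ / (2 * P.N), (r₄ / P.N, r₄ % P.N)))))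

/-- `digDecode` on codes: context `(P, r₀)`. [cite: AroraBarak2009, §1.3] -/
theorem codeFP_digDecode : CodeFP (pairE prmE natE) (pairE natE (pairE natE (pairE natE (pairE natE (pairE natE natE)))))
    (fun p => digDecode p.1 p.2) := by
  have hP := fst prmE natE
  have hr₀ := snd prmE natE
  have hN := codeFP_prm_N.comp hP
  have h2N := natMul.comp ((const _ 2).pair hN)
  have hT2N := natMul.comp ((codeFP_prm_T.comp hP).pair h2N)
  have hPP := natMul.comp ((const _ 2).pair hT2N)
  have hePP := natMul.comp ((codeFP_prm_e.comp hP).pair hPP)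
  have hr₁ := natMod.comp (hr₀.pair hePP)
  have hr₂ := natMod.comp (hr₁.pair hPP)
  have hr₃ := natMod.comp (hr₂.pair hT2N)
  have hr₄ := natMod.comp (hr₃.pair h2N)
  exact ((natDiv.comp (hr₀.pair hePP)).pair ((natDiv.comp (hr₁.pair hPP)).pair ((natDiv.comp (hr₂.pair hT2N)).pair ((natDiv.comp (hr₃.pair h2N)).pair
    ((natDiv.comp (hr₄.pair hN)).pair (natMod.comp (hr₄.pair hN))))))).congr fun p => by obtain ⟨P, r₀⟩ := p; rfl

/-- **The query of the round** (the round index is the length of the history). [cite: MicciancioPeikert2012, Thm. 3.1 proof (pp. 15–16)] -/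
def queryOfL (z : QCtx) : LData × List Bool :=
  let P := z.1.1
  let U := z.1.2
  let items := z.2.1
  let r := z.2.2.1
  let bits := z.2.2.2
  let idx := bits.length
  let nEst := (P.e + 1) * P.N'
  if decide (idx < nEst) then estQueryL P U.1 U.2.1 U.2.2.1 items r (idx / P.N') (idx % P.N')
  else
    let x := digDecode P (idx - nEst)
    let H : HPrm := (P.e, (P.T, (U.2.2.2.2.2.1, (P.G, nEst))))
    let i₀ := stepOfL bits U.2.2.1 U.2.2.2.2.2.2
    let L := LstateL bits H U.2.2.2.2.1 U.2.2.1 x.1 x.2.1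
    digQueryL ((P, (U.1, (U.2.2.2.1, U.2.2.1))), (items, (r, (x.1, (x.2.1, (x.2.2.1, (x.2.2.2.1, (x.2.2.2.2.1, (x.2.2.2.2.2, (i₀, L))))))))))

/-- **The query of the round on codes.** [cite: AroraBarak2009, §1.3] -/
theorem codeFP_queryOfL : CodeFP qCtxE (pairE ldataE strE) queryOfL := by
  have hP := (fst (pairE prmE unTE) (pairE (rawE itemE) (pairE strE strE))).fst'
  have hU := (fst (pairE prmE unTE) (pairE (rawE itemE) (pairE strE strE))).snd'
  have hrest := snd (pairE prmE unTE) (pairE (rawE itemE) (pairE strE strE))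
  have hitems := hrest.fst'
  have hr := hrest.snd'.fst'
  have hbits := hrest.snd'.snd'
  have hdu := hU.fst'
  have hKu := hU.snd'.fst'
  have heu := hU.snd'.snd'.fst'
  have hmu := hU.snd'.snd'.snd'.fst'
  have hTu := hU.snd'.snd'.snd'.snd'.fst'
  have hNu := hU.snd'.snd'.snd'.snd'.snd'.fst'
  have hN'u := hU.snd'.snd'.snd'.snd'.snd'.snd'
  have hidx := strNatLength.comp hbits
  have hnEst := natMul.comp ((natAdd.comp ((codeFP_prm_e.comp hP).pair (const _ 1))).pair (codeFP_prm_N'.comp hP))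
  have hcond := natLt.comp (hidx.pair hnEst)
  -- estimation branch
  have hest := codeFP_estQueryL.comp ((hP.pair (hdu.pair (hKu.pair heu))).pair (hitems.pair (hr.pair ((natDiv.comp (hidx.pair (codeFP_prm_N'.comp hP))).pair
    (natMod.comp (hidx.pair (codeFP_prm_N'.comp hP)))))))
  -- digit branch
  have hx := codeFP_digDecode.comp (hP.pair (natSub.comp (hidx.pair hnEst)))
  have hH := (codeFP_prm_e.comp hP).pair ((codeFP_prm_T.comp hP).pair (hNu.pair ((codeFP_prm_G.comp hP).pair hnEst)))
  have hi₀ := codeFP_stepOfL.comp (hbits.pair (heu.pair hN'u))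
  have hL := codeFP_LstateL.comp ((hbits.pair hH).pair (hTu.pair (heu.pair (hx.fst'.pair hx.snd'.fst'))))
  have hdig := codeFP_digQueryL.comp ((hP.pair (hdu.pair (hmu.pair heu))).pair (hitems.pair (hr.pair (hx.fst'.pair (hx.snd'.fst'.pair (hx.snd'.snd'.fst'.pair
    (hx.snd'.snd'.snd'.fst'.pair (hx.snd'.snd'.snd'.snd'.fst'.pair (hx.snd'.snd'.snd'.snd'.snd'.pair (hi₀.pair hL))))))))))
  exact (hcond.ite hest hdig).congr fun z => by
    obtain ⟨⟨P, du, Ku, eu, mu, Tu, Nu, N'u⟩, items, r, bits⟩ := z; rfl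

end Prog

end MP12

end LWE

end Literature.Computability.Cryptography
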